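import Summits.QuantumAdvantage.AdviceFreeQNC0.NPGamma37FourierFamily
import HarnessLib

/-!
# Cell qa-qnc0 — (NP-ΓΛ) part 3: the assembly `fourierLoss` and the theorems `ringHardFourierSparse3` ⊇ (NP-Γ), `ringHardLinForms3` (NP-Λ, dense linear forms)

Planner qa-qnc0-p2 gen 34 (INBOX P2-34g, memo HOME/qa-qnc0-p2/ROUND-34P2.md §4.8).  Part of the (NP-ΓΛ)/(NP-Λ) proof
`NPGamma37Fourier` (statements, Fourier inversion on `𝔽₃^R`, the class, the slice expansion) → `NPGamma37FourierFamily`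
(the explicit character family of a slice, numerics) → `NPGamma37FourierLoss` (assembly and the theorems
`ringHardFourierSparse3`, `ringHardLinForms3`).
-/

noncomputable section

namespace Summit.QuantumAdvantage.AdviceFreeQNC0.NPGamma37Proof

open Finset F4
open Classical
open Summit.QuantumAdvantage.AdviceFreeQNC0.AffBells37 (expo chiZ exists_ne_one_of_mass_lt ev L sparse sparse_ne_one
  two_pow_L_le ωz ωz_zero ωz_add ωz_natCast ωz_sq ωz_sum lin chiZ_eq_ωz lin_add lin_mul lin_single ιF_xor ιF_decide_eq_zero
  ιF_eq_omega ιF_ringWinU)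
open Summit.QuantumAdvantage.AdviceFreeQNC0.Resonance37G (four_orbit_le orbit_mgf sg bt sg_not slope_eq no_three
  blockCpl blockCpl_blockCpl blockCpl_involutive blockCpl_apply_of_not_mem uExt_blockCpl xN xN_eq_xOfU xN_blockCpl_of_ne
  xN_blockCpl_left xN_blockCpl_right Inv letter resonance_windows)
-- `wt` (weight of a cube-restricted character) is written `AffBells37.wt` throughout: the bare name would resolve to the
-- walk-word weight `Summit.QuantumAdvantage.AdviceFreeQNC0.wt` of `Elimination.lean`.

variable {F : ℕ}

section Fourier

open Literature.Computability.QuantumComplexity Literature.Computability.QuantumComplexity.RingHLF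
open Literature.Computability.MetaComplexity
open AffBells23 AffBells26
open Summit.QuantumAdvantage.AdviceFreeQNC0.NPGamma37 (NCoupled InsulatedWindows)

variable {n : ℕ}
variable {N : ℕ}
variable {R : ℕ}

/-! ### THE ASSEMBLY `fourierLoss` (verbatim (NP-Γ) `sparseLoss`, with `3^R` Fourier test rows per block) -/

/-- **THE LINEAR-FORMS SLICING THEOREM** (core form): for an interleaved window/insulator system of `F` windows in a walk
of length `n ≥ 4`, a strategy of the class `PQ Q f` with `8·3^R(n+1)3^F ≤ 4^F` and `32(n+1)F ≤ 2^F` wins at most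
`2ⁿ − 2ⁿ/(2·2^{L(K+1)})` odd inputs, `K = (n+1)·2·(3^R + 4F)` the size of the character family. -/
theorem fourierLoss {p q : ℕ → ℕ} (hord : ∀ j < F, q j < p j ∧ p j + 1 < q (j + 1)) (hqF : q F < n) (hn : 4 ≤ n)
    (Q : Fin (n + 1) → Fin R → Smolensky.CubeFn (ZMod 3) (n + 1)) (f : Fin (n + 1) → (Fin R → ZMod 3) → Bool)
    (hSA : ∀ (k : Fin R → ZMod 3) (g : Fin (n + 1)), SA (n := n) p F (QK Q k g))
    (hIA : ∀ (k : Fin R → ZMod 3) (g : Fin (n + 1)), IA p q F (QK Q k g))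
    (h34N : 8 * 3 ^ R * (n + 1) * 3 ^ F ≤ 4 ^ F) (h2C : 4 * (n + 1) * (8 * F) ≤ 2 ^ F) :
    (((univ.filter fun x : Fin (n + 1) → Bool => OddZeros x ∧ Rel x (zOf (PQ Q f) x)).card : ℕ) : ℝ)
      ≤ (2 : ℝ) ^ n - (2 : ℝ) ^ n / (2 * (2 : ℝ) ^ L (Fintype.card (IxL n F R) + 1)) := by
  have hS : Sep n F p := sep_of_ord hord hqF
  haveI := F4.nontrivial
  set P : Fin (n + 1) → Smolensky.CubeFn (ZMod 3) (n + 1) := PQ Q f with hPdef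
  -- wins and losses of the transported game
  set Los := univ.filter (fun u : Fin n → Bool => Wn P u = false) with hLos
  have hWL : (univ.filter fun u : Fin n → Bool => Wn P u = true).card + Los.card = 2 ^ n := by
    have h := Finset.card_filter_add_card_filter_not (s := (univ : Finset (Fin n → Bool)))
      (fun u => Wn P u = true)
    rw [card_univ, Fintype.card_fun, Fintype.card_bool, Fintype.card_fin] at h
    rw [← h, hLos]
    congr 2
    exact filter_congr fun u _ => by cases Wn P u <;> simp
  have hS1 := S1 (by omega) P
  -- masses of slices
  set K := Fintype.card (IxL n F R) with hK
  set massN : (Fin n → Bool) → ℕ := fun a => ∑ b : IxL n F R, 2 ^ (F - AffBells37.wt (rowsQ Q p a b)) with hmassN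
  set Good := univ.filter (fun a : Fin n → Bool => massN a < 2 ^ F) with hGood
  set Bad := univ.filter (fun a : Fin n → Bool => ¬ massN a < 2 ^ F) with hBad
  have hGB : Good.card + Bad.card = 2 ^ n := by
    rw [hGood, hBad, Finset.card_filter_add_card_filter_not, card_univ, Fintype.card_fun, Fintype.card_bool,
      Fintype.card_fin]
  -- Step A: a good slice loses `≥ 2^{F} / 2^{L(K+1)}` points
  set cnt : (Fin n → Bool) → ℕ := fun a => (univ.filter fun v : Fin F → Bool => Wn P (U p a v) = false).card
    with hcnt
  have hA : ∀ a ∈ Good, 2 ^ F ≤ 2 ^ L (K + 1) * cnt a := by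
    intro a ha
    rw [hGood, mem_filter] at ha
    have hex := exists_ne_one_of_mass_lt F univ (rowsQ Q p a) (coefsQ Q f p a) ha.2
    have hsp := sparse_ne_one F univ (rowsQ Q p a) (coefsQ Q f p a) hex
    rw [card_univ, ← hK, card_loss_sliceQ hS Q f hSA a] at hsp
    exact hsp
  -- Step B: summing over good slices and re-randomising: `#Good ≤ 2^{L(K+1)} · #Los`
  have hsumcnt : ∑ a : Fin n → Bool, cnt a = 2 ^ F * Los.card := by
    have h1 : ∀ a, cnt a = ∑ v : Fin F → Bool, (if Wn P (U p a v) = false then 1 else 0) := by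
      intro a; rw [hcnt]; exact card_filter _ _
    simp_rw [h1]
    rw [sum_comm, sum_sum_U p (fun u => if Wn P u = false then 1 else 0), hLos, card_filter]
  have hB : Good.card ≤ 2 ^ L (K + 1) * Los.card := by
    have h1 : Good.card * 2 ^ F ≤ 2 ^ L (K + 1) * (2 ^ F * Los.card) := by
      calc Good.card * 2 ^ F = ∑ a ∈ Good, 2 ^ F := by rw [sum_const, smul_eq_mul]
        _ ≤ ∑ a ∈ Good, 2 ^ L (K + 1) * cnt a := sum_le_sum hA
        _ ≤ ∑ a, 2 ^ L (K + 1) * cnt a :=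
            sum_le_sum_of_subset_of_nonneg (subset_univ _) fun _ _ _ => Nat.zero_le _
        _ = 2 ^ L (K + 1) * (2 ^ F * Los.card) := by rw [← mul_sum, hsumcnt]
    have hpos : 0 < 2 ^ F := by positivity
    rw [show 2 ^ L (K + 1) * (2 ^ F * Los.card) = (2 ^ L (K + 1) * Los.card) * 2 ^ F by ring] at h1
    exact Nat.le_of_mul_le_mul_right h1 hpos
  -- Step C: bad slices are rare (mass bookkeeping + resonance MGF + Markov)
  set C : ℕ := 2 * (n + 1) * (8 * F) with hC
  set T : (Fin n → Bool) → ℝ := fun a => ∑ g : Fin (n + 1), ∑ σ : Bool, ∑ k : Fin R → ZMod 3,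
      (2 : ℝ) ^ Zcount (F := F) (QK Q k) p a g (σv σ) 1 with hT
  have hmass : ∀ a, (massN a : ℝ) ≤ C + T a := by
    intro a
    have h := mass_rows_leQ (F := F) Q p a
    have h' : ((massN a : ℕ) : ℝ) ≤ ((2 * (n + 1) * (8 * F) +
        ∑ g : Fin (n + 1), ∑ σ : Bool, ∑ k : Fin R → ZMod 3,
          2 ^ Zcount (F := F) (QK Q k) p a g (σv σ) 1 : ℕ) : ℝ) := by
      exact_mod_cast h
    have hC' : (C : ℝ) = 2 * ((n : ℝ) + 1) * (8 * (F : ℝ)) := by rw [hC]; push_cast; ring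
    have hT' : T a = ∑ g : Fin (n + 1), ∑ σ : Bool, ∑ k : Fin R → ZMod 3,
        (2 : ℝ) ^ Zcount (F := F) (QK Q k) p a g (σv σ) 1 := rfl
    rw [hC', hT']
    push_cast at h'
    linarith
  have h3R : (Fintype.card (Fin R → ZMod 3) : ℝ) = (3 : ℝ) ^ R := by
    rw [Fintype.card_fun, ZMod.card, Fintype.card_fin]; push_cast; ring
  have hTsum : ∑ a : Fin n → Bool, T a ≤ 2 * (3 : ℝ) ^ R * (n + 1) * ((2 : ℝ) ^ n * (3 / 2 : ℝ) ^ F) := by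
    rw [hT, sum_comm]
    have hg : ∀ g : Fin (n + 1), ∑ a : Fin n → Bool, ∑ σ : Bool, ∑ k : Fin R → ZMod 3,
        (2 : ℝ) ^ Zcount (F := F) (QK Q k) p a g (σv σ) 1
          ≤ 2 * (3 : ℝ) ^ R * ((2 : ℝ) ^ n * (3 / 2 : ℝ) ^ F) := by
      intro g
      rw [sum_comm]
      have hσ : ∀ σ : Bool, ∑ a : Fin n → Bool, ∑ k : Fin R → ZMod 3,
          (2 : ℝ) ^ Zcount (F := F) (QK Q k) p a g (σv σ) 1
            ≤ (3 : ℝ) ^ R * ((2 : ℝ) ^ n * (3 / 2 : ℝ) ^ F) := by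
        intro σ
        rw [sum_comm]
        have hk : ∀ k : Fin R → ZMod 3, ∑ a : Fin n → Bool,
            (2 : ℝ) ^ Zcount (F := F) (QK Q k) p a g (σv σ) 1 ≤ (2 : ℝ) ^ n * (3 / 2 : ℝ) ^ F :=
          fun k => resonance_poly hord hqF (QK Q k) (hIA k) g (σv σ) 1 (σv_ne_zero σ) one_ne_zero
        calc _ ≤ ∑ _k : Fin R → ZMod 3, (2 : ℝ) ^ n * (3 / 2 : ℝ) ^ F := sum_le_sum fun k _ => hk k
          _ = (3 : ℝ) ^ R * ((2 : ℝ) ^ n * (3 / 2 : ℝ) ^ F) := by rw [sum_const, card_univ, nsmul_eq_mul, h3R]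
      calc _ ≤ ∑ σ : Bool, (3 : ℝ) ^ R * ((2 : ℝ) ^ n * (3 / 2 : ℝ) ^ F) := sum_le_sum fun σ _ => hσ σ
        _ = _ := by rw [Fintype.sum_bool]; ring
    calc _ ≤ ∑ g : Fin (n + 1), 2 * (3 : ℝ) ^ R * ((2 : ℝ) ^ n * (3 / 2 : ℝ) ^ F) := sum_le_sum fun g _ => hg g
      _ = _ := by rw [sum_const, card_univ, Fintype.card_fin]; ring
  have hBadR : (Bad.card : ℝ) * ((2 : ℝ) ^ F - C) ≤ 2 * (3 : ℝ) ^ R * (n + 1) * ((2 : ℝ) ^ n * (3 / 2 : ℝ) ^ F) := by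
    have h1 : ∀ a ∈ Bad, ((2 : ℝ) ^ F - C) ≤ T a := by
      intro a ha
      rw [hBad, mem_filter, not_lt] at ha
      have h2 : ((2 ^ F : ℕ) : ℝ) ≤ (massN a : ℝ) := by exact_mod_cast ha.2
      push_cast at h2
      linarith [hmass a]
    have hTnn : ∀ a, 0 ≤ T a := by
      intro a; rw [hT]
      exact sum_nonneg fun g _ => sum_nonneg fun σ _ => sum_nonneg fun k _ => by positivity
    calc (Bad.card : ℝ) * ((2 : ℝ) ^ F - C) = ∑ a ∈ Bad, ((2 : ℝ) ^ F - C) := by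
          rw [sum_const, nsmul_eq_mul]
      _ ≤ ∑ a ∈ Bad, T a := sum_le_sum h1
      _ ≤ ∑ a, T a := sum_le_sum_of_subset_of_nonneg (subset_univ _) fun a _ _ => hTnn a
      _ ≤ _ := hTsum
  -- Step D: the numbers
  have hC2 : 2 * (C : ℝ) ≤ (2 : ℝ) ^ F := by
    have h : 2 * C ≤ 2 ^ F := by
      calc 2 * C = 4 * (n + 1) * (8 * F) := by rw [hC]; ring
        _ ≤ 2 ^ F := h2C
    exact_mod_cast h
  have h34 : 8 * (3 : ℝ) ^ R * ((n : ℝ) + 1) * (3 : ℝ) ^ F ≤ (4 : ℝ) ^ F := by exact_mod_cast h34N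
  have hBadle : (Bad.card : ℝ) ≤ (2 : ℝ) ^ n / 2 := by
    have hpos2 : (0 : ℝ) < (2 : ℝ) ^ F := by positivity
    have hCnn : (0 : ℝ) ≤ C := by positivity
    have h1 : (Bad.card : ℝ) * ((2 : ℝ) ^ F / 2) ≤ 2 * (3 : ℝ) ^ R * (n + 1) * ((2 : ℝ) ^ n * (3 / 2 : ℝ) ^ F) := by
      have hb : (0 : ℝ) ≤ Bad.card := by positivity
      calc (Bad.card : ℝ) * ((2 : ℝ) ^ F / 2) ≤ (Bad.card : ℝ) * ((2 : ℝ) ^ F - C) :=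
            mul_le_mul_of_nonneg_left (by linarith) hb
        _ ≤ _ := hBadR
    have h32 : (3 / 2 : ℝ) ^ F * (2 : ℝ) ^ F = (3 : ℝ) ^ F := by
      rw [← mul_pow]; norm_num
    have h42 : (4 : ℝ) ^ F = (2 : ℝ) ^ F * (2 : ℝ) ^ F := by
      rw [← mul_pow]; norm_num
    have key : (8 * (3 : ℝ) ^ R * ((n : ℝ) + 1) * (3 / 2 : ℝ) ^ F) * (2 : ℝ) ^ F ≤ (2 : ℝ) ^ F * (2 : ℝ) ^ F := by
      calc (8 * (3 : ℝ) ^ R * ((n : ℝ) + 1) * (3 / 2 : ℝ) ^ F) * (2 : ℝ) ^ F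
          = 8 * (3 : ℝ) ^ R * ((n : ℝ) + 1) * ((3 / 2 : ℝ) ^ F * (2 : ℝ) ^ F) := by ring
        _ = 8 * (3 : ℝ) ^ R * ((n : ℝ) + 1) * (3 : ℝ) ^ F := by rw [h32]
        _ ≤ (4 : ℝ) ^ F := h34
        _ = (2 : ℝ) ^ F * (2 : ℝ) ^ F := h42
    have h34' : 8 * (3 : ℝ) ^ R * ((n : ℝ) + 1) * (3 / 2 : ℝ) ^ F ≤ (2 : ℝ) ^ F := le_of_mul_le_mul_right key hpos2
    have h2 : (Bad.card : ℝ) * ((2 : ℝ) ^ F / 2) ≤ ((2 : ℝ) ^ n / 2) * ((2 : ℝ) ^ F / 2) :=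
      h1.trans (by
        calc 2 * (3 : ℝ) ^ R * ((n : ℝ) + 1) * ((2 : ℝ) ^ n * (3 / 2 : ℝ) ^ F)
            = ((2 : ℝ) ^ n / 4) * (8 * (3 : ℝ) ^ R * ((n : ℝ) + 1) * (3 / 2 : ℝ) ^ F) := by ring
          _ ≤ ((2 : ℝ) ^ n / 4) * (2 : ℝ) ^ F := mul_le_mul_of_nonneg_left h34' (by positivity)
          _ = ((2 : ℝ) ^ n / 2) * ((2 : ℝ) ^ F / 2) := by ring)
    exact le_of_mul_le_mul_right h2 (by positivity)
  -- Step E: conclude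
  have hGoodR : (2 : ℝ) ^ n / 2 ≤ Good.card := by
    have h : ((Good.card + Bad.card : ℕ) : ℝ) = (2 : ℝ) ^ n := by rw [hGB]; push_cast; ring
    push_cast at h
    linarith
  have hLosR : (2 : ℝ) ^ n / 2 ≤ (2 : ℝ) ^ L (K + 1) * Los.card := by
    have h : (Good.card : ℝ) ≤ ((2 ^ L (K + 1) * Los.card : ℕ) : ℝ) := by exact_mod_cast hB
    push_cast at h
    linarith
  have hWR : ((univ.filter fun u : Fin n → Bool => Wn P u = true).card : ℝ) = (2 : ℝ) ^ n - Los.card := by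
    have h : (((univ.filter fun u : Fin n → Bool => Wn P u = true).card + Los.card : ℕ) : ℝ) = (2 : ℝ) ^ n := by
      rw [hWL]; push_cast; ring
    push_cast at h
    linarith
  have hpowL : (0 : ℝ) < (2 : ℝ) ^ L (K + 1) := by positivity
  calc (((univ.filter fun x : Fin (n + 1) → Bool => OddZeros x ∧ Rel x (zOf P x)).card : ℕ) : ℝ)
      ≤ ((univ.filter fun u : Fin n → Bool => Wn P u = true).card : ℝ) := by exact_mod_cast hS1
    _ = (2 : ℝ) ^ n - Los.card := hWR
    _ ≤ (2 : ℝ) ^ n - (2 : ℝ) ^ n / (2 * (2 : ℝ) ^ L (K + 1)) := by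
        have : (2 : ℝ) ^ n / (2 * (2 : ℝ) ^ L (K + 1)) ≤ Los.card := by
          rw [div_le_iff₀ (by positivity)]
          calc (2 : ℝ) ^ n = 2 * ((2 : ℝ) ^ n / 2) := by ring
            _ ≤ 2 * ((2 : ℝ) ^ L (K + 1) * Los.card) := by linarith
            _ = (Los.card : ℝ) * (2 * (2 : ℝ) ^ L (K + 1)) := by ring
        linarith

/-! ### (NP-ΓΛ) THE THEOREM -/

/-- **(NP-ΓΛ), explicit constants**: `e = 7`, `C = 8`, `n₀ = 200`, `R ≤ log₂ n` polynomials per output. -/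
theorem ringHardFourierSparse3_explicit : ∀ N ≥ 200, ∀ 𝓢 : Set (Finset (Fin N)),
    InsulatedWindows 𝓢 (8 * Nat.log 2 N) →
    ∀ R ≤ Nat.log 2 N, ∀ Q : Fin N → Fin R → Smolensky.CubeFn (ZMod 3) N,
      (∀ g i, Q g i ∈ Submodule.span (ZMod 3) (Smolensky.mono (ZMod 3) '' 𝓢)) →
      ∀ f : Fin N → (Fin R → ZMod 3) → Bool,
        ((univ.filter fun x : Fin N → Bool =>
            OddZeros x ∧ RingHLF.Rel x (fun g => f g (fun i => Q g i x))).card : ℝ)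
          ≤ (1 - 1 / (N : ℝ) ^ 7) * (2 : ℝ) ^ (N - 1) := by
  intro N hN 𝓢 hW R hR Q hQ f
  obtain ⟨n, rfl⟩ : ∃ n, N = n + 1 := ⟨N - 1, by omega⟩
  obtain ⟨p, q, _, hqF3, hord, h4, h5⟩ := hW
  obtain ⟨h1, h2⟩ := H1'_H2'_of_insulated h4 h5
  have hqF : q (8 * Nat.log 2 (n + 1)) < n := by omega
  have hS := sep_of_ord hord hqF
  have hSAIA := SAIA_of_span hS h1 h2 Q hQ
  obtain ⟨h34N, h2C, hK, -⟩ := numericsΛ (R := R) hN hR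
  have hmain := fourierLoss hord hqF (by omega) Q f (fun k g => (hSAIA k g).1) (fun k g => (hSAIA k g).2) h34N h2C
  rw [card_IxL] at hmain
  have hflt : (univ.filter fun x : Fin (n + 1) → Bool => OddZeros x ∧ RingHLF.Rel x (fun g => f g (fun i => Q g i x)))
      = (univ.filter fun x : Fin (n + 1) → Bool => OddZeros x ∧ Rel x (zOf (PQ Q f) x)) :=
    filter_congr fun x _ => by rw [zOf_PQ]; exact Iff.rfl
  rw [hflt, show n + 1 - 1 = n from rfl]
  push_cast
  exact law_of_loss hmain hK

/-- **(NP-ΓΛ) PROVED**: `RingHardFourierSparse3` with `e = 7`, `C = 8`, `n₀ = 200`. -/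
theorem ringHardFourierSparse3 : RingHardFourierSparse3 := ⟨7, 8, 200, ringHardFourierSparse3_explicit⟩

/-! ### (NP-Λ) THE DENSE LINEAR-FORMS THEOREM -/

/-- **(NP-Λ), explicit constants**: `e = 7`, `n₀ = 200`, `R ≤ log₂ n` linear forms per output; windows `p_j = 3j + 3`,
insulators `q_i = 3i + 2`. -/
theorem ringHardLinForms3_explicit : ∀ N ≥ 200, ∀ R ≤ Nat.log 2 N, ∀ Lf : Fin N → Fin R → Fin N → ZMod 3,
    ∀ f : Fin N → (Fin R → ZMod 3) → Bool,
      ((univ.filter fun x : Fin N → Bool =>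
          OddZeros x ∧ RingHLF.Rel x (fun g => f g (fun i => ∑ m : Fin N, if x m then Lf g i m else 0))).card : ℝ)
        ≤ (1 - 1 / (N : ℝ) ^ 7) * (2 : ℝ) ^ (N - 1) := by
  intro N hN R hR Lf f
  obtain ⟨n, rfl⟩ : ∃ n, N = n + 1 := ⟨N - 1, by omega⟩
  obtain ⟨h34N, h2C, hK, h24⟩ := numericsΛ (R := R) hN hR
  -- the window/insulator system `p_j = 3j + 3`, `q_i = 3i + 2`, `F = 8k` windows
  have hord : ∀ j < 8 * Nat.log 2 (n + 1), (fun i => 3 * i + 2) j < (fun j => 3 * j + 3) j ∧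
      (fun j => 3 * j + 3) j + 1 < (fun i => 3 * i + 2) (j + 1) := by
    intro j _; simp only; omega
  have hqF : (fun i => 3 * i + 2) (8 * Nat.log 2 (n + 1)) < n := by simp only; omega
  have hS := sep_of_ord hord hqF
  set Q : Fin (n + 1) → Fin R → Smolensky.CubeFn (ZMod 3) (n + 1) := fun g i => LinF (Lf g i) with hQdef
  have hQ : ∀ g i, Q g i ∈ Submodule.span (ZMod 3) (Smolensky.mono (ZMod 3) '' Sing (n + 1)) :=
    fun g i => LinF_mem_span (Lf g i)
  have hSAIA := SAIA_of_span hS (H1'_sing hS) (H2'_sing hord) Q hQ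
  have hmain := fourierLoss hord hqF (by omega) Q f (fun k g => (hSAIA k g).1) (fun k g => (hSAIA k g).2) h34N h2C
  rw [card_IxL] at hmain
  have hflt : (univ.filter fun x : Fin (n + 1) → Bool =>
        OddZeros x ∧ RingHLF.Rel x (fun g => f g (fun i => ∑ m : Fin (n + 1), if x m then Lf g i m else 0)))
      = (univ.filter fun x : Fin (n + 1) → Bool => OddZeros x ∧ Rel x (zOf (PQ Q f) x)) :=
    filter_congr fun x _ => by rw [zOf_PQ]; exact Iff.rfl
  rw [hflt, show n + 1 - 1 = n from rfl]
  push_cast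
  exact law_of_loss hmain hK

/-- **(NP-Λ) PROVED**: `RingHardLinForms3` with `e = 7`, `n₀ = 200`. -/
theorem ringHardLinForms3 : RingHardLinForms3 := ⟨7, 200, ringHardLinForms3_explicit⟩

end Fourier

end Summit.QuantumAdvantage.AdviceFreeQNC0.NPGamma37Proof
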